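import Literature.AnabelianGeometry.EtaleTheta.ArithThetaTowerDivisorsGeom
import HarnessLib

/-!
# [EtTh] Def. 3.3 (iii) / Rmk. 3.3.1 at the theta envelope — GAP A item GA-10 (file 3, keeper-A pin π3 / RULINGS #339 `pull_dichotomy` input): the
# PRIMARY RAYS of `Φ₀^geom` (Galois orbits of prime log-divisors) and the DICHOTOMY for pull-backs along endomorphisms — identity, or a
# primary ray carried off itself (class (b))

S. Mochizuki, *The étale theta function …*, Publ. RIMS **45** (2009) [MochizukiEtTh2009], Def. 3.3 (iii) p.299 (PDF p.73), Rmk. 3.3.1 p.299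
(«the set of primes [cf. [FrdI], §0] of the monoid `Div⁺(Z^log_∞)^{Gal(Z^log_∞/Y^log)}` … is in natural bijective correspondence with the set of
`Gal(Z^log_∞/Y^log)`-orbits of prime log-divisors on `Z^log_∞`») [cite: MochizukiEtTh2009, Rmk 3.3.1 p.73]; S. Mochizuki, *The geometry of
Frobenioids I* (2008) [MochizukiFrdI2008], §0 p.12 (`≼`, primary elements), Def. 1.1 (i) p.19 (non-dilating endomorphisms).

abc-iut cell, GAP A (gap G-L5-EX32I-1), item **GA-10** (KEY 14a1f2d9768383e4), file 3 = the spec-keeper's pin π3 (board 20:59:06Z: «the ONE lemma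
that is GA-08's whole H+ input under R-FI/ρ2, generic in (Γ, C) and index-free: `Envelope.phiZeroPull_dichotomy`») = the geometric coordinate of the
seventh `CarrierSpec` field `pull_dichotomy` of abc-iut-L5-lead RULINGS #339 (1).  CLASS (b) CONSTRUCTION (3 defs `ev`/`InRay`/`rayFun`-`rayDIV`-`ray`
+ theorems; pattern = abc-iut-w5-d179's `ZTower.phiZeroPull_dichotomy`, `LogDivisorModelZTowerRays.lean`, here for the level model
`Envelope.model C` with its deck action `Envelope.action C Γ` of files 1–2, ★ p668511 / `ArithThetaTowerDivisorsGeom.lean`).  For a `Γ`-set `S` with base point `s₀` and a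
prime log-divisor `x₀ ∈ (C × Bool) ⊔ C`:
* `Envelope.ev S ψ s x` — the multiplicity of `ψ ∈ Φ₀(S)` at `(s, x)`; `ev_ρ` (equivariance: `ev ψ (g·s) x = ev ψ s (g⁻¹·x)`);
* `Envelope.InRay S s₀ x₀ s x` — «`(s, x)` lies in the `Γ`-orbit of `(s₀, x₀)`»; `inRay_ρ_iff` (translation law);
* **`Envelope.ray S s₀ x₀ ∈ Φ₀(S)`** — the indicator of that orbit: ONE PRIME of `Φ₀(S)` in the sense of Rmk. 3.3.1; **`isPrimary_ray`** ([FrdI] §0):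
  an element `b ≼ ray` vanishes off the orbit and elements of `Φ₀(S)` are CONSTANT on orbits (`ev_eq_ev_base_of_inRay`), so `b = ray^c`
  (`eq_ray_pow_of_precsim_ray`);
* **`Envelope.phiZeroPull_dichotomy`** — for `S` connected and ANY endomorphism `f : S → S` (`f s₀ = g₀·s₀`): EITHER every `(s₀, g₀·x)` stays in the
  orbit of `(s₀, x)` and the pull-back `Φ₀(f)` is the IDENTITY of `Φ₀(S)`, OR for some `x₀` the primary ray `e_{(s₀,x₀)}` is carried off itself,
  `¬ (Φ₀(f)(e) ≼ e)`; read over the coset category: **`divisorsGeom_Φ₀_map_dichotomy`** — for every endomorphism `f` of `Γ/U` in `CosetCat Γ`,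
  `Φ₀^geom(f)` is the identity or moves a primary element off itself (GA-12 discharges `CarrierSpec.pull_dichotomy` from this on the geometric
  coordinate; the `OrdInt (Ω^{aug U})` coordinate is fixed by GA-01's `v_map`).
HONEST FRAMING: combinatorics of the divisor/Galois skeleton of the LABELLED finite-level transport of [EtTh] §1 (files 1–2); no Prop-valued fact, no
instance, no notation, no sorry; nothing here bears on [IUTchIII] Cor. 3.12; NO side taken (D-0045); typed ≠ inhabited ≠ proved-in-print;
count-neutral; NO abc claim.
-/

noncomputable section

namespace Literature.AnabelianGeometry.EtaleTheta

namespace ArithThetaTower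

/-! ## §1 Values of the elements of `Φ₀(S)` at a point and a prime log-divisor -/

namespace Envelope

open CategoryTheory Literature.AlgebraicGeometry.Frobenioids LogDivisorModel LogDivisorModel.GaloisAction

variable {C : Type} {Γ : Type} [Group Γ] [MulAction Γ C] (S : Action (Type 0) Γ)

/-- `1` acts trivially on the points. [folklore] -/
private theorem ρ_one_apply (s : S.V) : S.ρ 1 s = s := by
  rw [map_one]
  rfl

/-- `(g h)·s = g·(h·s)`. [folklore] -/
private theorem ρ_mul_apply (g h : Γ) (s : S.V) : S.ρ (g * h) s = S.ρ g (S.ρ h s) := by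
  rw [map_mul]
  rfl

/-- Morphisms of `Γ`-sets are equivariant, pointwise. [folklore] -/
private theorem hom_ρ_apply {S' : Action (Type 0) Γ} (f : S ⟶ S') (g : Γ) (s : S.V) : f.hom (S.ρ g s) = S'.ρ g (f.hom s) := by
  have h := f.comm g
  exact congrFun (congrArg (fun ψ : S.V ⟶ S'.V => (ψ : S.V → S'.V)) h) s

/-- The multiplicity of `ψ ∈ Φ₀(S)` at the point `s` and the prime log-divisor `x` (an integer, `≥ 0`).
[cite: MochizukiEtTh2009, Def 3.1 p.70] -/
def ev (ψ : (action C Γ).phiZero S) (s : S.V) (x : Idx C) : ℤ := Multiplicative.toAdd (ψ.1 s) x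

/-- `ev` of a product. [cite: MochizukiEtTh2009, Def 3.1 p.70] -/
theorem ev_mul (ψ χ : (action C Γ).phiZero S) (s : S.V) (x : Idx C) : ev S (ψ * χ) s x = ev S ψ s x + ev S χ s x := rfl

/-- `ev` of a power. [cite: MochizukiEtTh2009, Def 3.1 p.70] -/
theorem ev_pow (ψ : (action C Γ).phiZero S) (k : ℕ) (s : S.V) (x : Idx C) : ev S (ψ ^ k) s x = k * ev S ψ s x := by
  induction k with
  | zero => rw [pow_zero, Nat.cast_zero, zero_mul]; rfl
  | succ k ih => rw [pow_succ, ev_mul, ih, Nat.cast_succ]; ring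

/-- Multiplicities are non-negative (the values of `ψ` are effective). [cite: MochizukiEtTh2009, Def 3.1 p.70] -/
theorem ev_nonneg (ψ : (action C Γ).phiZero S) (s : S.V) (x : Idx C) : 0 ≤ ev S ψ s x := (ψ.2.1 s).2 x

/-- Elements of `Φ₀(S)` are determined by their multiplicities. [cite: MochizukiEtTh2009, Def 3.1 p.70] -/
theorem ext_ev {ψ χ : (action C Γ).phiZero S} (h : ∀ s x, ev S ψ s x = ev S χ s x) : ψ = χ :=
  Subtype.ext (funext fun s => Multiplicative.toAdd.injective (funext fun x => h s x))

/-- **Equivariance on multiplicities**: `ev ψ (g·s) x = ev ψ s (g⁻¹·x)`. [cite: MochizukiEtTh2009, Def 3.3 p.73] -/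
theorem ev_ρ (ψ : (action C Γ).phiZero S) (g : Γ) (s : S.V) (x : Idx C) :
    ev S ψ (S.ρ g s) x = ev S ψ s ((permIdx C Γ g).symm x) := by
  unfold ev
  rw [ψ.2.2 g s]
  rfl

/-! ## §2 The ray of a prime log-divisor: the reduced `Γ`-orbit of `(s₀, x₀)` as an element of `Φ₀(S)` (Rmk. 3.3.1) -/

/-- **`InRay s₀ x₀ s x`**: the prime log-divisor `(s, x)` lies in the `Γ`-orbit of `(s₀, x₀)`. [cite: MochizukiEtTh2009, Rmk 3.3.1 p.73] -/
def InRay (s₀ : S.V) (x₀ : Idx C) (s : S.V) (x : Idx C) : Prop := ∃ g : Γ, S.ρ g s₀ = s ∧ permIdx C Γ g x₀ = x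

/-- `(s₀, x₀)` lies in its own orbit. [cite: MochizukiEtTh2009, Rmk 3.3.1 p.73] -/
theorem inRay_self (s₀ : S.V) (x₀ : Idx C) : InRay S s₀ x₀ s₀ x₀ :=
  ⟨1, ρ_one_apply S s₀, by rw [map_one]; rfl⟩

/-- `(g·s₀, g·x₀)` lies in the orbit of `(s₀, x₀)`. [cite: MochizukiEtTh2009, Rmk 3.3.1 p.73] -/
theorem inRay_ρ_self (s₀ : S.V) (x₀ : Idx C) (g : Γ) : InRay S s₀ x₀ (S.ρ g s₀) (permIdx C Γ g x₀) := ⟨g, rfl, rfl⟩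

/-- **Translation law**: `(g·s, x)` is in the orbit iff `(s, g⁻¹·x)` is. [cite: MochizukiEtTh2009, Rmk 3.3.1 p.73] -/
theorem inRay_ρ_iff (s₀ : S.V) (x₀ : Idx C) (s : S.V) (g : Γ) (x : Idx C) :
    InRay S s₀ x₀ (S.ρ g s) x ↔ InRay S s₀ x₀ s ((permIdx C Γ g).symm x) := by
  constructor
  · rintro ⟨h, hs, hx⟩
    refine ⟨g⁻¹ * h, ?_, ?_⟩
    · rw [ρ_mul_apply, hs, ← ρ_mul_apply, inv_mul_cancel, ρ_one_apply]
    · rw [map_mul, Equiv.Perm.mul_apply, hx, ← Equiv.Perm.inv_def, map_inv]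
  · rintro ⟨h, hs, hx⟩
    refine ⟨g * h, ?_, ?_⟩
    · rw [ρ_mul_apply, hs]
    · rw [map_mul, Equiv.Perm.mul_apply, hx, Equiv.apply_symm_apply]

open Classical in
/-- The indicator of the orbit of `(s₀, x₀)` over the point `s`: `1` on the prime log-divisors `x` with `(s, x)` in the orbit, `0` elsewhere.
[cite: MochizukiEtTh2009, Rmk 3.3.1 p.73] -/
def rayFun (s₀ : S.V) (x₀ : Idx C) (s : S.V) (x : Idx C) : ℤ := if InRay S s₀ x₀ s x then 1 else 0

/-- `rayFun = 1` on the orbit. [cite: MochizukiEtTh2009, Rmk 3.3.1 p.73] -/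
theorem rayFun_of_inRay {s₀ : S.V} {x₀ : Idx C} {s : S.V} {x : Idx C} (h : InRay S s₀ x₀ s x) : rayFun S s₀ x₀ s x = 1 := if_pos h

/-- `rayFun = 0` off the orbit. [cite: MochizukiEtTh2009, Rmk 3.3.1 p.73] -/
theorem rayFun_of_not_inRay {s₀ : S.V} {x₀ : Idx C} {s : S.V} {x : Idx C} (h : ¬ InRay S s₀ x₀ s x) : rayFun S s₀ x₀ s x = 0 := if_neg h

/-- `0 ≤ rayFun ≤ 1`. [cite: MochizukiEtTh2009, Rmk 3.3.1 p.73] -/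
theorem rayFun_nonneg (s₀ : S.V) (x₀ : Idx C) (s : S.V) (x : Idx C) : 0 ≤ rayFun S s₀ x₀ s x := by
  by_cases h : InRay S s₀ x₀ s x
  · rw [rayFun_of_inRay S h]; exact zero_le_one
  · rw [rayFun_of_not_inRay S h]

/-- Translation law for the indicator. [cite: MochizukiEtTh2009, Rmk 3.3.1 p.73] -/
theorem rayFun_ρ (s₀ : S.V) (x₀ : Idx C) (s : S.V) (g : Γ) (x : Idx C) :
    rayFun S s₀ x₀ (S.ρ g s) x = rayFun S s₀ x₀ s ((permIdx C Γ g).symm x) := by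
  by_cases h : InRay S s₀ x₀ s ((permIdx C Γ g).symm x)
  · rw [rayFun_of_inRay S ((inRay_ρ_iff S s₀ x₀ s g x).2 h), rayFun_of_inRay S h]
  · rw [rayFun_of_not_inRay S (fun h' => h ((inRay_ρ_iff S s₀ x₀ s g x).1 h')), rayFun_of_not_inRay S h]

/-- The log-divisor over the point `s` supported, with multiplicity one, on the prime log-divisors in the orbit of `(s₀, x₀)`.
[cite: MochizukiEtTh2009, Rmk 3.3.1 p.73] -/
def rayDIV (s₀ : S.V) (x₀ : Idx C) (s : S.V) : (model C).DIV := Multiplicative.ofAdd (α := Idx C → ℤ) (rayFun S s₀ x₀ s)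

/-- Multiplicities of `rayDIV`. [cite: MochizukiEtTh2009, Rmk 3.3.1 p.73] -/
theorem toAdd_rayDIV (s₀ : S.V) (x₀ : Idx C) (s : S.V) (x : Idx C) : Multiplicative.toAdd (rayDIV S s₀ x₀ s) x = rayFun S s₀ x₀ s x := rfl

/-- `rayDIV` is effective and Cartier. [cite: MochizukiEtTh2009, Def 3.1 p.70] -/
theorem rayDIV_mem_Divplus (s₀ : S.V) (x₀ : Idx C) (s : S.V) : rayDIV S s₀ x₀ s ∈ (model C).Divplus :=
  ⟨trivial, fun x => rayFun_nonneg S s₀ x₀ s x⟩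

/-- `rayDIV` is equivariant (translation law of the orbit). [cite: MochizukiEtTh2009, Def 3.3 p.73] -/
theorem rayDIV_ρ (s₀ : S.V) (x₀ : Idx C) (s : S.V) (g : Γ) :
    rayDIV S s₀ x₀ (S.ρ g s) = (action C Γ).actDIV g (rayDIV S s₀ x₀ s) :=
  Multiplicative.toAdd.injective (funext fun x => by
    change rayFun S s₀ x₀ (S.ρ g s) x = rayFun S s₀ x₀ s ((permIdx C Γ g).symm x)
    exact rayFun_ρ S s₀ x₀ s g x)

/-- **The ray `e_{(s₀, x₀)} ∈ Φ₀(S)`**: the reduced `Γ`-orbit of the prime log-divisor `(s₀, x₀)` — ONE prime of `Φ₀(S)` in the sense of Rmk. 3.3.1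
(«the set of primes … is in natural bijective correspondence with the set of … orbits of prime log-divisors»). [cite: MochizukiEtTh2009, Rmk 3.3.1 p.73] -/
def ray (s₀ : S.V) (x₀ : Idx C) : (action C Γ).phiZero S :=
  ⟨fun s => rayDIV S s₀ x₀ s, fun s => rayDIV_mem_Divplus S s₀ x₀ s, fun g s => rayDIV_ρ S s₀ x₀ s g⟩

/-- Multiplicity `1` on the orbit. [cite: MochizukiEtTh2009, Rmk 3.3.1 p.73] -/
theorem ev_ray_of_inRay {s₀ : S.V} {x₀ : Idx C} {s : S.V} {x : Idx C} (h : InRay S s₀ x₀ s x) : ev S (ray S s₀ x₀) s x = 1 := by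
  change rayFun S s₀ x₀ s x = 1
  rw [rayFun_of_inRay S h]

/-- Multiplicity `0` off the orbit. [cite: MochizukiEtTh2009, Rmk 3.3.1 p.73] -/
theorem ev_ray_of_not_inRay {s₀ : S.V} {x₀ : Idx C} {s : S.V} {x : Idx C} (h : ¬ InRay S s₀ x₀ s x) : ev S (ray S s₀ x₀) s x = 0 := by
  change rayFun S s₀ x₀ s x = 0
  rw [rayFun_of_not_inRay S h]

/-- The ray is not trivial. [cite: MochizukiEtTh2009, Rmk 3.3.1 p.73] -/
theorem ray_ne_one (s₀ : S.V) (x₀ : Idx C) : ray S s₀ x₀ ≠ 1 := fun h => by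
  have h1 : ev S (ray S s₀ x₀) s₀ x₀ = 0 := by rw [h]; rfl
  rw [ev_ray_of_inRay S (inRay_self S s₀ x₀)] at h1
  exact one_ne_zero h1

/-! ## §3 Elements of `Φ₀(S)` are constant on orbits; the ray is PRIMARY -/

/-- **Elements of `Φ₀(S)` are constant on the orbit of `(s₀, x₀)`** (equivariance). [cite: MochizukiEtTh2009, Rmk 3.3.1 p.73] -/
theorem ev_eq_ev_base_of_inRay (ψ : (action C Γ).phiZero S) {s₀ : S.V} {x₀ : Idx C} {s : S.V} {x : Idx C} (h : InRay S s₀ x₀ s x) :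
    ev S ψ s x = ev S ψ s₀ x₀ := by
  obtain ⟨g, rfl, rfl⟩ := h
  rw [ev_ρ, Equiv.symm_apply_apply]

/-- An element `b ≼ e` (i.e. `b ∣ e^k`, `k ≥ 1`) VANISHES off the orbit. [cite: MochizukiFrdI2008, §0 p.12] -/
theorem ev_eq_zero_of_precsim_ray {s₀ : S.V} {x₀ : Idx C} {b : (action C Γ).phiZero S} (hb : Precsim b (ray S s₀ x₀)) {s : S.V} {x : Idx C}
    (h : ¬ InRay S s₀ x₀ s x) : ev S b s x = 0 := by
  obtain ⟨k, -, c, hc⟩ := hb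
  have h1 := congrArg (fun ψ => ev S ψ s x) hc
  simp only [ev_pow, ev_mul, ev_ray_of_not_inRay S h, mul_zero] at h1
  have hb0 := ev_nonneg S b s x
  have hc0 := ev_nonneg S c s x
  omega

/-- **An element `b ≼ e` is a power of the ray**: `b = e^c` with `c` its multiplicity at `(s₀, x₀)`. [cite: MochizukiFrdI2008, §0 p.12] -/
theorem eq_ray_pow_of_precsim_ray {s₀ : S.V} {x₀ : Idx C} {b : (action C Γ).phiZero S} (hb : Precsim b (ray S s₀ x₀)) :
    b = ray S s₀ x₀ ^ (ev S b s₀ x₀).toNat :=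
  ext_ev S fun s x => by
    rw [ev_pow]
    by_cases h : InRay S s₀ x₀ s x
    · rw [ev_eq_ev_base_of_inRay S b h, ev_ray_of_inRay S h, mul_one, Int.toNat_of_nonneg (ev_nonneg S b s₀ x₀)]
    · rw [ev_eq_zero_of_precsim_ray S hb h, ev_ray_of_not_inRay S h, mul_zero]

/-- **The ray is a PRIMARY element of `Φ₀(S)`** ([FrdI] §0: `≠ 1`, and `e ≼ b` for every non-trivial `b ≼ e`). [cite: MochizukiFrdI2008, §0 p.12] -/
theorem isPrimary_ray (s₀ : S.V) (x₀ : Idx C) : IsPrimary (ray S s₀ x₀) := by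
  refine ⟨ray_ne_one S s₀ x₀, fun b hb hba => ?_⟩
  have e := eq_ray_pow_of_precsim_ray S hba
  have hc : (ev S b s₀ x₀).toNat ≠ 0 := fun h0 => hb (by rw [e, h0, pow_zero])
  exact ⟨1, one_pos, by rw [pow_one, e]; exact dvd_pow_self _ hc⟩

/-! ## §4 Pull-backs along endomorphisms: the DICHOTOMY (GA-08's H+ input, keeper-A pin π3 / RULINGS #339 `pull_dichotomy`) -/

variable {S}

/-- **Periodicity**: if `(s₀, g₀·x)` lies in the orbit of `(s₀, x)` for EVERY prime log-divisor `x`, then translating the profile at `s₀` by `g₀`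
changes nothing: `ψ(g₀·s₀) = ψ(s₀)`. [cite: MochizukiEtTh2009, Rmk 3.3.1 p.73] -/
theorem apply_ρ_eq_of_forall_inRay (ψ : (action C Γ).phiZero S) {s₀ : S.V} {g₀ : Γ}
    (h : ∀ x : Idx C, InRay S s₀ x s₀ (permIdx C Γ g₀ x)) : ψ.1 (S.ρ g₀ s₀) = ψ.1 s₀ :=
  Multiplicative.toAdd.injective (funext fun x => by
    change ev S ψ (S.ρ g₀ s₀) x = ev S ψ s₀ x
    rw [ev_ρ]
    have hx := h ((permIdx C Γ g₀).symm x)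
    rw [Equiv.apply_symm_apply] at hx
    exact (ev_eq_ev_base_of_inRay S ψ hx).symm)

/-- **THE DICHOTOMY.** For a connected `S` and ANY endomorphism `f` (`f s₀ = g₀·s₀`): EITHER every prime log-divisor `(s₀, g₀·x)` stays in the orbit
of `(s₀, x)` and the pull-back `Φ₀(f)` is the IDENTITY of `Φ₀(S)`, OR some primary ray `e_{(s₀, x₀)}` is carried off itself, `¬ (Φ₀(f)(e) ≼ e)`
(the shape of abc-iut-w5-d179's `ZTower.phiZeroPull_dichotomy`; at `S = Γ/U`: the endomorphism `γU ↦ γg₀U` either fixes every `U`-orbit of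
`(C × Bool) ⊔ C` or moves one, carrying its indicator off itself) — the input of [FrdI] Def. 1.1 (i) «non-dilating» along EVERY endomorphism.
[cite: MochizukiFrdI2008, Def. 1.1 (i) p.19] -/
theorem phiZeroPull_dichotomy (hS : isConnectedGSet S) (f : S ⟶ S) :
    (∀ ψ : (action C Γ).phiZero S, (action C Γ).phiZeroPull f ψ = ψ) ∨
      ∃ p : (action C Γ).phiZero S, IsPrimary p ∧ ¬ Precsim ((action C Γ).phiZeroPull f p) p := by
  obtain ⟨⟨s₀⟩, htrans⟩ := (isConnectedGSet_iff S).1 hS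
  obtain ⟨g₀, hg₀⟩ := htrans s₀ (f.hom s₀)
  by_cases hper : ∀ x : Idx C, InRay S s₀ x s₀ (permIdx C Γ g₀ x)
  · refine Or.inl fun ψ => Subtype.ext (funext fun s => ?_)
    obtain ⟨g, rfl⟩ := htrans s₀ s
    rw [phiZeroPull_apply, hom_ρ_apply S f g s₀, ← hg₀, ψ.2.2 g (S.ρ g₀ s₀), apply_ρ_eq_of_forall_inRay ψ hper, ← ψ.2.2 g s₀]
  · obtain ⟨x₀, hx₀⟩ := not_forall.mp hper
    refine Or.inr ⟨ray S s₀ x₀, isPrimary_ray S s₀ x₀, fun hprec => ?_⟩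
    have h0 := ev_eq_zero_of_precsim_ray S hprec hx₀
    have h1 : ev S ((action C Γ).phiZeroPull f (ray S s₀ x₀)) s₀ (permIdx C Γ g₀ x₀) = ev S (ray S s₀ x₀) (f.hom s₀) (permIdx C Γ g₀ x₀) := rfl
    rw [h1, ← hg₀, ev_ray_of_inRay S (inRay_ρ_self S s₀ x₀ g₀)] at h0
    exact one_ne_zero h0

/-- The same dichotomy with `Φ₀(f)` read as the functor `PhiZero` on the morphism `f`. [cite: MochizukiFrdI2008, Def. 1.1 (i) p.19] -/
theorem PhiZero_map_dichotomy (hS : isConnectedGSet S) (f : S ⟶ S) :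
    (∀ ψ : (action C Γ).phiZero S, ((action C Γ).PhiZero.map f.op).hom ψ = ψ) ∨
      ∃ p : (action C Γ).phiZero S, IsPrimary p ∧ ¬ Precsim (((action C Γ).PhiZero.map f.op).hom p) p :=
  phiZeroPull_dichotomy hS f

end Envelope

/-! ## §5 The dichotomy at the geometric envelope data `divisorsGeom Γ C` over `CosetCat Γ` -/

section Geom

open CategoryTheory Opposite Literature.AlgebraicGeometry.Frobenioids Literature.AnabelianGeometry.SemiGraphs LogDivisorModel
  LogDivisorModel.GaloisAction

variable (Γ : Type) [Group Γ] [TopologicalSpace Γ] (C : Type) [MulAction Γ C]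

/-- **`Φ₀^geom` pull-back dichotomy over the coset category**: for every endomorphism `f` of an object `Γ/U` of `CosetCat Γ`, the pull-back
`Φ₀^geom(f)` is the identity or carries a primary element off itself (RULINGS #339 `CarrierSpec.pull_dichotomy`, geometric coordinate; the
`OrdInt (Ω^{aug U})` coordinate is fixed by GA-01's `v_map`). [cite: MochizukiFrdI2008, Def. 1.1 (i) p.19] -/
theorem divisorsGeom_Φ₀_map_dichotomy (U : CosetCat Γ) (f : U ⟶ U) :
    (∀ ψ : (divisorsGeom Γ C).Φ₀.obj (op U), ((divisorsGeom Γ C).Φ₀.map f.op).hom ψ = ψ) ∨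
      ∃ p : (divisorsGeom Γ C).Φ₀.obj (op U), IsPrimary p ∧ ¬ Precsim (((divisorsGeom Γ C).Φ₀.map f.op).hom p) p :=
  Envelope.phiZeroPull_dichotomy (isConnectedGSet_cosetGSetFunctor_obj Γ U) ((cosetGSetFunctor Γ).map f)

end Geom

end ArithThetaTower

end Literature.AnabelianGeometry.EtaleTheta

end
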